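import Summits.AtomisticToContinuum.FouriersLaw.Theorems.BondHeatUncertaintyExtensiveSnapshotIrreversibilityEnergyWindowDivergenceSeam

/-!
# Crux `ExtensiveSnapshotIrreversibility` (stmt-AtomisticToContinuum-9121), fixed-`N` half `K_fix`:
the EXCESS `KL − Δ` of a flipped tilt — pointwise two-sided control and the one-state tail bound
(node «UniformIntegrabilityLadder», 1/4)

(helper file, theorem-side; decomp-a2c lens-1 «grading / quantitative ladder», generation 90.)

For a tilt `μ = μ₀ · e^{φ}` of a flip-invariant probability measure `μ₀` (`Θ (q, p) = (q, −p)`),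
`ψ := φ − φ∘Θ`, `f := e^{φ}`, `f̃ := e^{φ∘Θ}`, the divergence ladder of generation 89
(`…EnergyWindowDivergenceSeam`) compares `KL(μ ‖ Θ_*μ) = ½ ∫ ψ (f − f̃) dμ₀` with the triangular
discrimination `Δ = ∫ (f − f̃)²/(f + f̃) dμ₀` through the pointwise sandwich
`t ≤ k ≤ (1 + |ψ|/2) t`, `k ≤ ½ |ψ| (f + f̃)` (`k = ½ ψ (f − f̃)`, `t = (f − f̃)²/(f + f̃)`).
This file controls the EXCESS `k − t ≥ 0` FROM BELOW on the level set `{|ψ| ≥ η}`: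

* `half_sub_mul_sub_triangular_eq` — the exact form
  `k − t = (eᵃ + eᵇ) · G(u) · (u/2 − G(u))`, `u = |a − b|`, `G(u) = (eᵘ − 1)/(eᵘ + 1) = tanh(u/2)`;
* `exp_sub_one_div_exp_add_one_mono` (`G` is monotone) and `exp_sub_one_div_mul_strictAntiOn`
  (`F(u) = G(u)/u` is strictly antitone on `(0, ∞)`: the derivative numerator is
  `−(e^{2u} − 2u eᵘ − 1) = −2eᵘ (sinh u − u) < 0`);
* `excessSlope η = G(η) (½ − F(η)) > 0` (`excessSlope_pos`) and ★ `excessSlope_mul_le`: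
  `η ≤ |a − b| ⟹ excessSlope η · |a − b| (eᵃ + eᵇ) ≤ k − t` (both factors of
  `(k − t)/(u (eᵃ + eᵇ)) = G(u)(½ − F(u))` are nonnegative and monotone in `u`);
* one state: `setIntegral_abs_mul_add_eq_two_mul` (the flipped half of the tail equals the unflipped
  one on the flip-symmetric level set) and ★ `mul_setIntegral_abs_mul_exp_le_toReal_klDiv_sub`:
  `2 · excessSlope η · ∫_{|ψ| > η} |ψ| e^{φ} dμ₀ ≤ KL(μ ‖ Θ_*μ) − Δ`.

Together with generation 89's upper split `KL ≤ (1 + η/2) Δ + ∫_{|ψ|>η} |ψ| e^{φ} dμ₀` this makes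
the level-set tail `∫_{|ψ|>η} |ψ| dμ` two-sided equivalent to the excess `KL − Δ` at every fixed
level, which is what turns the tail atom of the ladder into a NECESSARY condition (`…ExcessFilter`,
`…ExcessAtoms`).  No new objects besides the explicit constant `excessSlope`. [folklore]
-/

noncomputable section

namespace Summit.AtomisticToContinuum.FouriersLaw.Theorems.ExtensiveSnapshotIrreversibility.EnergyWindow

open MeasureTheory Filter Topology InformationTheory Real
open scoped ENNReal NNReal
open Literature.MathematicalPhysics.KineticTheory.HeatConduction
open Summit.AtomisticToContinuum.FouriersLaw.Theorems.ExtensiveSnapshotIrreversibility.Negative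
open Summit.AtomisticToContinuum.FouriersLaw.Theorems.ExtensiveSnapshotIrreversibility.ClausiusBudget.OddLogDensity

variable {N : ℕ}

/-! ## 1. Pointwise: the excess `k − t` in closed form and its lower bound on `{|a − b| ≥ η}` -/

/-- `G(u) = (eᵘ − 1)/(eᵘ + 1) = tanh(u/2)` is monotone (`G = 1 − 2/(eᵘ + 1)`). [folklore] -/
theorem exp_sub_one_div_exp_add_one_mono {u v : ℝ} (huv : u ≤ v) :
    (exp u - 1) / (exp u + 1) ≤ (exp v - 1) / (exp v + 1) := by
  rw [div_le_div_iff₀ (by positivity) (by positivity)]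
  nlinarith [exp_le_exp.2 huv, exp_pos u, exp_pos v]

/-- `0 ≤ G(u)` for `0 ≤ u`. [folklore] -/
theorem exp_sub_one_div_exp_add_one_nonneg {u : ℝ} (hu : 0 ≤ u) :
    0 ≤ (exp u - 1) / (exp u + 1) :=
  div_nonneg (by linarith [one_le_exp hu]) (by positivity)

/-- `F(u) = (eᵘ − 1)/(u (eᵘ + 1)) = tanh(u/2)/u` is strictly antitone on `(0, ∞)`: its derivative
has numerator `2u eᵘ − e^{2u} + 1 = −eᵘ (eᵘ − e^{−u} − 2u) < 0` (`u < sinh u` for `u > 0`).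
[folklore] -/
theorem exp_sub_one_div_mul_strictAntiOn :
    StrictAntiOn (fun u : ℝ => (exp u - 1) / (u * (exp u + 1))) (Set.Ioi 0) := by
  refine strictAntiOn_of_deriv_neg (convex_Ioi 0) ?_ fun u hu => ?_
  · refine ContinuousOn.div (continuous_exp.sub continuous_const).continuousOn
      (continuous_id.mul (continuous_exp.add continuous_const)).continuousOn fun u hu => ?_
    have hu0 : 0 < u := hu
    positivity
  · rw [interior_Ioi] at hu
    have hu0 : 0 < u := hu
    have hd : HasDerivAt (fun u : ℝ => (exp u - 1) / (u * (exp u + 1)))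
        ((exp u * (u * (exp u + 1)) - (exp u - 1) * (1 * (exp u + 1) + u * exp u)) /
          (u * (exp u + 1)) ^ 2) u :=
      ((hasDerivAt_exp u).sub_const 1).div ((hasDerivAt_id' u).mul
        ((hasDerivAt_exp u).add_const 1)) (by positivity)
    rw [hd.deriv]
    refine div_neg_of_neg_of_pos ?_ (by positivity)
    have hs : u < Real.sinh u := Real.self_lt_sinh_iff.2 hu0
    rw [Real.sinh_eq] at hs
    have hs' : 2 * u * exp u < (exp u - exp (-u)) * exp u := by
      have := mul_lt_mul_of_pos_right hs (exp_pos u)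
      linarith
    have h2 : exp (-u) * exp u = 1 := by rw [← exp_add]; simp
    nlinarith [hs', h2]

/-- `F(u) ≤ ½` for `u > 0` (`2 (eᵘ − 1) ≤ u (eᵘ + 1)`, `two_mul_exp_sub_one_le`). [folklore] -/
theorem exp_sub_one_div_mul_le_half {u : ℝ} (hu : 0 < u) :
    (exp u - 1) / (u * (exp u + 1)) ≤ 1 / 2 := by
  rw [div_le_iff₀ (by positivity)]
  have := two_mul_exp_sub_one_le hu.le
  linarith

/-- **The excess slope** `excessSlope η = G(η) (½ − F(η))`,
`G(η) = (e^η − 1)/(e^η + 1)`, `F(η) = G(η)/η`: the value at `u = η` of the nondecreasing function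
`(k − t)/(u (eᵃ + eᵇ))`, `u = |a − b|` (the best constant in `excessSlope_mul_le`). [folklore] -/
def excessSlope (η : ℝ) : ℝ :=
  (exp η - 1) / (exp η + 1) * (1 / 2 - (exp η - 1) / (η * (exp η + 1)))

/-- `excessSlope η > 0` for `η > 0` (`G(η) > 0`; `F(η) < F(η/2) ≤ ½` by strict antitonicity).
[folklore] -/
theorem excessSlope_pos {η : ℝ} (hη : 0 < η) : 0 < excessSlope η := by
  unfold excessSlope
  refine mul_pos (div_pos (by linarith [one_lt_exp_iff.2 hη]) (by positivity)) ?_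
  have h1 : (exp η - 1) / (η * (exp η + 1)) < (exp (η / 2) - 1) / (η / 2 * (exp (η / 2) + 1)) :=
    exp_sub_one_div_mul_strictAntiOn (Set.mem_Ioi.2 (by positivity : 0 < η / 2))
      (Set.mem_Ioi.2 hη) (by linarith)
  have h2 := exp_sub_one_div_mul_le_half (by positivity : 0 < η / 2)
  linarith

/-- `excessSlope` is nondecreasing on `(0, ∞)` (product of two nonnegative nondecreasing factors).
[folklore] -/
theorem excessSlope_le_of_le {η u : ℝ} (hη : 0 < η) (hηu : η ≤ u) :
    excessSlope η ≤ (exp u - 1) / (exp u + 1) * (1 / 2 - (exp u - 1) / (u * (exp u + 1))) := by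
  unfold excessSlope
  have hu : 0 < u := hη.trans_le hηu
  have hF : (exp u - 1) / (u * (exp u + 1)) ≤ (exp η - 1) / (η * (exp η + 1)) :=
    (exp_sub_one_div_mul_strictAntiOn.antitoneOn) (Set.mem_Ioi.2 hη) (Set.mem_Ioi.2 hu) hηu
  refine mul_le_mul (exp_sub_one_div_exp_add_one_mono hηu) (by linarith) ?_
    (exp_sub_one_div_exp_add_one_nonneg hu.le)
  have := exp_sub_one_div_mul_le_half hη
  linarith

/-- Completing the square: `2cg (eᵃ − eᵇ) − c² g² (eᵃ + eᵇ) ≤ (eᵃ − eᵇ)²/(eᵃ + eᵇ)`. [folklore] -/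
theorem two_mul_sub_sq_mul_le_triangular (a b c g : ℝ) :
    2 * c * g * (exp a - exp b) - c ^ 2 * g ^ 2 * (exp a + exp b) ≤
      (exp a - exp b) ^ 2 / (exp a + exp b) := by
  have hpos : 0 < exp a + exp b := by positivity
  rw [le_div_iff₀ hpos]
  nlinarith [sq_nonneg ((exp a - exp b) - c * g * (exp a + exp b)), hpos]

/-- Weak continuity from linear response: if `(a_δ − a₀)/δ` converges as `δ → 0`, `δ ≠ 0`, then
`a_δ → a₀`. [folklore] -/
theorem tendsto_of_tendsto_sub_div {a : ℝ → ℝ} {a₀ L : ℝ}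
    (h : Tendsto (fun δ => (a δ - a₀) / δ) (𝓝[≠] (0 : ℝ)) (𝓝 L)) :
    Tendsto a (𝓝[≠] (0 : ℝ)) (𝓝 a₀) := by
  have hδ : Tendsto (fun δ : ℝ => δ) (𝓝[≠] (0 : ℝ)) (𝓝 0) :=
    tendsto_id.mono_left nhdsWithin_le_nhds
  have h1 := (h.mul hδ).add_const a₀
  rw [mul_zero, zero_add] at h1
  refine h1.congr' ?_
  filter_upwards [self_mem_nhdsWithin] with δ hδ
  have hδ' : δ ≠ 0 := hδ
  field_simp
  ring

/-- **The excess in closed form**: with `u = a − b`, `G(u) = (eᵘ − 1)/(eᵘ + 1)` (odd in `u`),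
`½ (a − b)(eᵃ − eᵇ) − (eᵃ − eᵇ)²/(eᵃ + eᵇ) = (eᵃ + eᵇ) · G(u) · (u/2 − G(u))`
(`eᵃ − eᵇ = (eᵃ + eᵇ) G(u)`). [folklore] -/
theorem half_sub_mul_sub_triangular_eq (a b : ℝ) :
    (a - b) * (exp a - exp b) / 2 - (exp a - exp b) ^ 2 / (exp a + exp b) =
      (exp a + exp b) * ((exp (a - b) - 1) / (exp (a - b) + 1)) *
        ((a - b) / 2 - (exp (a - b) - 1) / (exp (a - b) + 1)) := by
  have hV : exp a = exp b * exp (a - b) := by rw [← exp_add]; congr 1; ring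
  have hb : 0 < exp b := exp_pos b
  have hV1 : 0 < exp (a - b) + 1 := by positivity
  rw [hV]
  have hS : exp b * exp (a - b) + exp b = exp b * (exp (a - b) + 1) := by ring
  rw [hS]
  field_simp

/-- ★ **Lower bound of the excess on the level set.** For `0 < η ≤ |a − b|`:
`excessSlope η · |a − b| (eᵃ + eᵇ) ≤ ½ (a − b)(eᵃ − eᵇ) − (eᵃ − eᵇ)²/(eᵃ + eᵇ)`
(`(k − t)/(u (eᵃ + eᵇ)) = G(u)(½ − G(u)/u)` is a product of two nonnegative factors, each
nondecreasing in `u = |a − b|`). [folklore] -/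
theorem excessSlope_mul_le {η a b : ℝ} (hη : 0 < η) (hηab : η ≤ |a - b|) :
    excessSlope η * (|a - b| * (exp a + exp b)) ≤
      (a - b) * (exp a - exp b) / 2 - (exp a - exp b) ^ 2 / (exp a + exp b) := by
  -- reduce to `b ≤ a`
  wlog hab : b ≤ a generalizing a b
  · have hba : a ≤ b := le_of_not_ge hab
    have h := this (a := b) (b := a) (by rwa [abs_sub_comm]) hba
    have e1 : (exp b - exp a) ^ 2 = (exp a - exp b) ^ 2 := by ring
    have e2 : exp b + exp a = exp a + exp b := by ring
    have e3 : (b - a) * (exp b - exp a) = (a - b) * (exp a - exp b) := by ring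
    rwa [e1, e2, e3, abs_sub_comm] at h
  have hu : |a - b| = a - b := abs_of_nonneg (sub_nonneg.2 hab)
  rw [hu] at hηab ⊢
  have hupos : 0 < a - b := hη.trans_le hηab
  rw [half_sub_mul_sub_triangular_eq a b]
  have hslope := excessSlope_le_of_le hη hηab
  -- `(a−b)/2 − G = (a−b) (½ − F)`
  have hGF : (a - b) / 2 - (exp (a - b) - 1) / (exp (a - b) + 1) =
      (a - b) * (1 / 2 - (exp (a - b) - 1) / ((a - b) * (exp (a - b) + 1))) := by
    field_simp
  rw [hGF]
  have hS : 0 ≤ exp a + exp b := by positivity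
  calc excessSlope η * ((a - b) * (exp a + exp b))
      = (exp a + exp b) * (a - b) * excessSlope η := by ring
    _ ≤ (exp a + exp b) * (a - b) * ((exp (a - b) - 1) / (exp (a - b) + 1) *
          (1 / 2 - (exp (a - b) - 1) / ((a - b) * (exp (a - b) + 1)))) :=
        mul_le_mul_of_nonneg_left hslope (by positivity)
    _ = _ := by ring

/-- `0 ≤ k − t` (generation 89's `triangular_le_half_sub_mul`, restated as a difference).
[folklore] -/
theorem half_sub_mul_sub_triangular_nonneg (a b : ℝ) :
    0 ≤ (a - b) * (exp a - exp b) / 2 - (exp a - exp b) ^ 2 / (exp a + exp b) :=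
  sub_nonneg.2 (triangular_le_half_sub_mul a b)

/-! ## 2. One state: the tail is controlled by the excess `KL − Δ` -/

section OneState

variable (μ₀ : Measure (PhaseSpace N))

/-- **The flipped half of the tail.** On the flip-symmetric level set `A = {|ψ| > η}`
(`ψ = φ − φ∘Θ` is odd under `Θ`), for a flip-invariant `μ₀` and `|ψ| e^{φ} ∈ L¹(μ₀)`:
`∫_A |ψ| (e^{φ} + e^{φ∘Θ}) dμ₀ = 2 ∫_A |ψ| e^{φ} dμ₀`. [folklore] -/
theorem setIntegral_abs_mul_add_eq_two_mul
    (hinv : μ₀.map (fun x : PhaseSpace N => (x.1, -x.2)) = μ₀)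
    {φ : PhaseSpace N → ℝ} (hφm : Measurable φ)
    (h1 : Integrable (fun x => |φ x - φ (x.1, -x.2)| * exp (φ x)) μ₀) (η : ℝ) :
    ∫ x in {x | η < |φ x - φ (x.1, -x.2)|},
        |φ x - φ (x.1, -x.2)| * (exp (φ x) + exp (φ (x.1, -x.2))) ∂μ₀ =
      2 * ∫ x in {x | η < |φ x - φ (x.1, -x.2)|}, |φ x - φ (x.1, -x.2)| * exp (φ x) ∂μ₀ := by
  set ψ : PhaseSpace N → ℝ := fun x => φ x - φ (x.1, -x.2) with hψ
  have hΘm : Measurable (fun x : PhaseSpace N => (x.1, -x.2)) := (momentumReversal N).measurable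
  have hψm : Measurable ψ := hφm.sub (hφm.comp hΘm)
  have hψodd : ∀ x : PhaseSpace N, ψ (x.1, -x.2) = -ψ x := fun x => by simp [hψ]
  set A : Set (PhaseSpace N) := {x | η < |ψ x|} with hA
  have hAm : MeasurableSet A := measurableSet_lt measurable_const hψm.abs
  have hAΘ : ∀ x : PhaseSpace N, ((x.1, -x.2) ∈ A) = (x ∈ A) := fun x => by
    simp only [hA, Set.mem_setOf_eq, hψodd x, abs_neg]
  have h1' : Integrable (fun x => |ψ x| * exp (φ (x.1, -x.2))) μ₀ := by
    have h := (integrable_comp_flip_iff μ₀ hinv (fun x => |ψ x| * exp (φ x))).2 h1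
    refine h.congr (ae_of_all _ fun x => ?_)
    simp only [hψodd x, abs_neg]
  set G : PhaseSpace N → ℝ := fun x => |ψ x| * exp (φ x) with hG
  have hflip : ∫ x, A.indicator (fun x => |ψ x| * exp (φ (x.1, -x.2))) x ∂μ₀ =
      ∫ x, A.indicator G x ∂μ₀ := by
    rw [← integral_comp_flip μ₀ hinv (A.indicator G)]
    refine integral_congr_ae (ae_of_all _ fun x => ?_)
    change A.indicator (fun x => |ψ x| * exp (φ (x.1, -x.2))) x = A.indicator G (x.1, -x.2)
    by_cases hx : x ∈ A
    · have hxΘ : (x.1, -x.2) ∈ A := by rw [hAΘ x]; exact hx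
      rw [Set.indicator_of_mem hxΘ, Set.indicator_of_mem hx, hG]
      simp only [hψodd x, abs_neg]
    · have hxΘ : (x.1, -x.2) ∉ A := by rw [hAΘ x]; exact hx
      rw [Set.indicator_of_notMem hxΘ, Set.indicator_of_notMem hx]
  change ∫ x in A, |ψ x| * (exp (φ x) + exp (φ (x.1, -x.2))) ∂μ₀ = 2 * ∫ x in A, G x ∂μ₀
  have hsplit : ∀ x, |ψ x| * (exp (φ x) + exp (φ (x.1, -x.2))) =
      G x + |ψ x| * exp (φ (x.1, -x.2)) := fun x => by simp only [hG]; ring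
  simp_rw [hsplit]
  rw [integral_add h1.integrableOn h1'.integrableOn, ← integral_indicator hAm,
    ← integral_indicator hAm, hflip]
  ring

variable [IsProbabilityMeasure μ₀]

/-- ★ **The tail is controlled by the excess, one state.** For a tilt `μ = μ₀ · e^{φ}`
(`∫ e^{φ} dμ₀ = 1`) of a flip-invariant probability measure with `|ψ| e^{φ} ∈ L¹(μ₀)` and a level
`η > 0`: `2 · excessSlope η · ∫_{|ψ|>η} |ψ| e^{φ} dμ₀ ≤ KL(μ ‖ Θ_*μ) − Δ`,
`Δ = ∫ (e^{φ} − e^{φ∘Θ})²/(e^{φ} + e^{φ∘Θ}) dμ₀`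
(`KL − Δ = ∫ (k − t) dμ₀ ≥ ∫_A (k − t) dμ₀ ≥ excessSlope η ∫_A |ψ| (e^{φ} + e^{φ∘Θ}) dμ₀`,
`excessSlope_mul_le`, `k − t ≥ 0`). [folklore] -/
theorem mul_setIntegral_abs_mul_exp_le_toReal_klDiv_sub
    (hinv : μ₀.map (fun x : PhaseSpace N => (x.1, -x.2)) = μ₀)
    {φ : PhaseSpace N → ℝ} (hφm : Measurable φ) (hexp : Integrable (fun x => exp (φ x)) μ₀)
    (hZ1 : ∫ x, exp (φ x) ∂μ₀ = 1) {η : ℝ} (hη : 0 < η)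
    (h1 : Integrable (fun x => |φ x - φ (x.1, -x.2)| * exp (φ x)) μ₀) :
    2 * excessSlope η *
        ∫ x in {x | η < |φ x - φ (x.1, -x.2)|}, |φ x - φ (x.1, -x.2)| * exp (φ x) ∂μ₀ ≤
      (klDiv (μ₀.tilted φ) ((μ₀.tilted φ).map (fun x : PhaseSpace N => (x.1, -x.2)))).toReal -
        ∫ x, (exp (φ x) - exp (φ (x.1, -x.2))) ^ 2 / (exp (φ x) + exp (φ (x.1, -x.2))) ∂μ₀ := by
  set ψ : PhaseSpace N → ℝ := fun x => φ x - φ (x.1, -x.2) with hψ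
  have hΘm : Measurable (fun x : PhaseSpace N => (x.1, -x.2)) := (momentumReversal N).measurable
  have hψm : Measurable ψ := hφm.sub (hφm.comp hΘm)
  have hψodd : ∀ x : PhaseSpace N, ψ (x.1, -x.2) = -ψ x := fun x => by simp [hψ]
  set A : Set (PhaseSpace N) := {x | η < |ψ x|} with hA
  have hAm : MeasurableSet A := measurableSet_lt measurable_const hψm.abs
  -- integrability of the pieces
  have hw : Integrable (fun x => ψ x * exp (φ x)) μ₀ := by
    refine h1.mono' (hψm.mul hφm.exp).aestronglyMeasurable (ae_of_all _ fun x => ?_)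
    rw [Real.norm_eq_abs, abs_mul, abs_of_pos (exp_pos _)]
  have hw' : Integrable (fun x => ψ x * exp (φ (x.1, -x.2))) μ₀ := by
    have h := (integrable_comp_flip_iff μ₀ hinv (fun x => -(ψ x * exp (φ x)))).2 hw.neg
    refine h.congr (ae_of_all _ fun x => ?_)
    simp only [hψodd x]
    ring
  have h1' : Integrable (fun x => |ψ x| * exp (φ (x.1, -x.2))) μ₀ := by
    have h := (integrable_comp_flip_iff μ₀ hinv (fun x => |ψ x| * exp (φ x))).2 h1
    refine h.congr (ae_of_all _ fun x => ?_)
    simp only [hψodd x, abs_neg]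
  have ht := integrable_triangular μ₀ hinv hφm hexp
  have hk : Integrable (fun x => (1 / 2 : ℝ) * (ψ x * (exp (φ x) - exp (φ (x.1, -x.2))))) μ₀ := by
    refine ((hw.sub hw').const_mul (1 / 2 : ℝ)).congr (ae_of_all _ fun x => ?_)
    simp only [Pi.sub_apply]
    ring
  set g : PhaseSpace N → ℝ := fun x => |ψ x| * (exp (φ x) + exp (φ (x.1, -x.2))) with hg
  have hgi : Integrable g μ₀ := by
    refine (h1.add h1').congr (ae_of_all _ fun x => ?_)
    simp only [hg, Pi.add_apply]
    ring
  have hgA : Integrable (A.indicator fun x => excessSlope η * g x) μ₀ :=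
    (hgi.const_mul _).indicator hAm
  -- the value of `KL`
  obtain ⟨-, hval⟩ := toReal_klDiv_flip_tilted_eq_half_integral μ₀ hinv hφm hexp hZ1 hw
  -- pointwise: the indicator of `excessSlope η · g` is below the excess
  have hpt : ∀ x, A.indicator (fun x => excessSlope η * g x) x ≤
      (1 / 2 : ℝ) * (ψ x * (exp (φ x) - exp (φ (x.1, -x.2)))) -
        (exp (φ x) - exp (φ (x.1, -x.2))) ^ 2 / (exp (φ x) + exp (φ (x.1, -x.2))) := by
    intro x
    have h0 := half_sub_mul_sub_triangular_nonneg (φ x) (φ (x.1, -x.2))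
    by_cases hx : x ∈ A
    · rw [Set.indicator_of_mem hx]
      have hle : η ≤ |ψ x| := le_of_lt hx
      have h := excessSlope_mul_le (a := φ x) (b := φ (x.1, -x.2)) hη hle
      simp only [hg, hψ] at h ⊢
      linarith
    · rw [Set.indicator_of_notMem hx]
      simp only [hψ] at h0 ⊢
      linarith
  have hlow : ∫ x, A.indicator (fun x => excessSlope η * g x) x ∂μ₀ ≤
      ∫ x, ((1 / 2 : ℝ) * (ψ x * (exp (φ x) - exp (φ (x.1, -x.2)))) -
        (exp (φ x) - exp (φ (x.1, -x.2))) ^ 2 / (exp (φ x) + exp (φ (x.1, -x.2)))) ∂μ₀ :=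
    integral_mono hgA (hk.sub ht) hpt
  rw [integral_indicator hAm, integral_sub hk ht, integral_const_mul, integral_const_mul] at hlow
  have hsym := setIntegral_abs_mul_add_eq_two_mul μ₀ hinv hφm h1 η
  simp only [hA, hg, hψ] at hlow
  rw [hsym] at hlow
  rw [hval]
  linarith

end OneState

end Summit.AtomisticToContinuum.FouriersLaw.Theorems.ExtensiveSnapshotIrreversibility.EnergyWindow

end
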